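import Summits.ResolutionOfSingularities.ResolutionOfSingularities.Theorems.EquisingularLiftEquisingularLiftNatTransitionKernelCharts
import Summits.ResolutionOfSingularities.ResolutionOfSingularities.Theorems.EquisingularLiftEquisingularLiftNatRegularSequenceRestrict
import Mathlib.AlgebraicGeometry.PullbackCarrier
import Mathlib.RingTheory.Regular.RegularSequence
import HarnessLib

/-!
# [OURS · L1 W4.5(b) · EL♮(3) · (T-k) · J1c brick B4, chart dictionary D0/D3/D4] The special fibre inside the level `Wₘ`:
# charts, kernels `𝔪·Γ(Wₘ, U)`, the ideal of `Y₀` as the image of the ideal of `Yₙ`, and the weakly-regular lift data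

Crux EL♮(3) = stmt-ResolutionOfSingularities-20148 (child of EL♮ stmt-…-20038; bookkeeping crux `EquisingularLift` stmt-…-15660); J1 =
`EmbeddedInfinitesimalLiftFact` (p596985) ⟸ `EmbeddedInfinitesimalChartLiftFact` (p603689). Written by res-L1-w45b-stub-2 g12 as CO-HAND of
res-L1-w45b-stub-4 g10's brick B4 = (λ♯) (`L/res-type-027/J1c-DESIGN-v2.md` §2, desk R5 (ii)); the dictionary entries D0/D3/D4 of stub-4's census
(STATUS 2026-08-28T04:57:42Z), in the currency of D1 `ker_app_transition_eq_map` (p606078). OURS; NOT a statement of H. Hironaka's 2017 manuscript;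
AI-written, weaker than expert review. No `sorry`; standard axioms; DEF-FREE. `--supports stmt-ResolutionOfSingularities-20148 --as helper`.

SETTING (binders of `EmbeddedInfinitesimalLiftFact`): `O` a DVR, `θ : O ↠ k`, `w : W ⟶ Spec O` with special-fibre model square `(jW, tW)` over `Spec θ`;
levels `Wₘ = infinitesimalNeighbourhood 𝔪 w m` (`ι`, `toSpec`, `transition`); `Y₀ ↪ W₀` (`ι`), `Yₙ ↪ Wₙ` (`jn`), the square `s₀`.
CURRENCY. The special fibre enters a level through ANY `e : W₀ ⟶ Wₘ` with `e ≫ ι = jW`, `e ≫ toSpec = tW ≫ Spec θm`, for ANY level residue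
`θm : O ⧸ 𝔪ᵐ⁺¹ →+* k` with `θm ∘ mk = θ` (both exist: `exists_levelResidue`, `exists_specialFibre_toLevel`; no definitions are introduced).
CONTENT.
* §0 `ker_levelResidue_eq : ker θm = 𝔪(O ⧸ 𝔪ᵐ⁺¹)`, `eq_map_maximalIdeal_of_isPrime` (the level has one prime), `surjective_specMap_levelResidue`.
* §0′ `isPullback_of_fac_mono` (a pullback square over `Z` whose corner maps factor through a mono `W ↪ Z` is a pullback square over `W`),
  `exists_list_map_eq_of_forall_mem_map` (lift a list along a surjection inside an ideal), `isWeaklyRegular_quotient_of_surjective`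
  (`φ : A ↠ B`, `as.map φ` weakly regular on `B` ⇒ `as` weakly regular on the `A`-module `A ⧸ ker φ` — the shape of (λ)'s `hreg`),
  `ker_comp_app_eq_comap`.
* §1 `isPullback_specialFibre_toLevel : IsPullback e tW (toSpec m) (Spec θm)`, hence `e` is a closed immersion and surjective;
  `exists_affineOpens_preimage_le` (small AFFINE charts of the level inside a prescribed open, seen from `W₀`); **D3a**
  `ker_app_specialFibre_toLevel : ker (Γ(Wₘ, U) → Γ(W₀, e⁻¹U)) = 𝔪·Γ(Wₘ, U)` (+ the `comap` twin shaped like D1); `app_specialFibre_toLevel_surjective`;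
  **D0** `flat_appLE_toSpec : (toSpec m).appLE ⊤ U` is flat when `w` is.
* §2 **D4** `ker_ideal_fibre_eq_map : 𝓘_{Y₀}(e⁻¹U) = K(U)·Γ(W₀, e⁻¹U)`, `K(U) = (t.app U)⁻¹(ker jn.app (t⁻¹U))` the ideal of `Yₙ` read in `Γ(Wₙ₊₁, U)`
  (via `isPullback_fibre_of_isPullback_ι : Y₀ = Yₙ ×_{Wₙ₊₁} W₀`, the `s₀` square descended through the mono `ι (n+1)`); and the **B4 INPUT PACKAGE**
  `exists_chart_weaklyRegular_lift_data`: at a point of `Y₀`, an affine chart `U` of `Wₙ₊₁` inside any prescribed open with a list `a' ⊆ K(U)` weakly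
  regular on `Γ(U) ⧸ 𝔪Γ(U)` generating `K(U)` mod `𝔪` — literally the hypotheses `hreg`/`hmem`/`hgen` of the ring core
  `exists_flat_lift_sup_eq_of_isWeaklyRegular_fiber` (p606077). [cite: GortzWedhorn2020, Example 4.36 (p. 139)]
-/

set_option linter.dupNamespace false

noncomputable section
open CategoryTheory CategoryTheory.Limits AlgebraicGeometry TopologicalSpace
open Literature.AlgebraicGeometry.Morphisms (infinitesimalNeighbourhood)
open IsLocalRing

namespace Summit.ResolutionOfSingularities.ResolutionOfSingularities.Cruxes.EquisingularLiftNat.Sections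

/-! ## §0 The residue map of a level `O ⧸ 𝔪ᵐ⁺¹ → k` -/

section Algebra

variable {O : Type} [CommRing O] [IsDomain O] [IsDiscreteValuationRing O] {k : Type} [Field k] (θ : O →+* k)

/-- A surjection from a local ring onto a field has kernel the maximal ideal. [folklore] -/
theorem ker_eq_maximalIdeal_of_surjective (hθ : Function.Surjective θ) : RingHom.ker θ = maximalIdeal O :=
  IsLocalRing.eq_maximalIdeal (RingHom.ker_isMaximal_of_surjective θ hθ)

/-- The residue surjection `θ : O → k` factors through every level `O ⧸ 𝔪ᵐ⁺¹`. [folklore] -/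
theorem exists_levelResidue (hθ : Function.Surjective θ) (m : ℕ) :
    ∃ θm : O ⧸ maximalIdeal O ^ (m + 1) →+* k, θm.comp (Ideal.Quotient.mk _) = θ := by
  refine ⟨Ideal.Quotient.lift (maximalIdeal O ^ (m + 1)) θ fun a ha => ?_, ?_⟩
  · have ha' : a ∈ maximalIdeal O := Ideal.pow_le_self (Nat.succ_ne_zero m) ha
    rw [← ker_eq_maximalIdeal_of_surjective θ hθ] at ha'
    exact ha'
  · ext a
    simp

variable {θ} {m : ℕ} {θm : O ⧸ maximalIdeal O ^ (m + 1) →+* k}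

/-- A level residue map is surjective. [folklore] -/
theorem levelResidue_surjective (hθ : Function.Surjective θ) (hθm : θm.comp (Ideal.Quotient.mk _) = θ) :
    Function.Surjective θm := by
  have h : Function.Surjective (θm ∘ Ideal.Quotient.mk (maximalIdeal O ^ (m + 1))) := by
    rw [← RingHom.coe_comp, hθm]; exact hθ
  exact h.of_comp

/-- The kernel of a level residue map is `𝔪(O ⧸ 𝔪ᵐ⁺¹)`. [folklore] -/
theorem ker_levelResidue_eq (hθ : Function.Surjective θ) (hθm : θm.comp (Ideal.Quotient.mk _) = θ) :
    RingHom.ker θm = (maximalIdeal O).map (Ideal.Quotient.mk (maximalIdeal O ^ (m + 1))) := by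
  have h1 : RingHom.ker θ = (RingHom.ker θm).comap (Ideal.Quotient.mk (maximalIdeal O ^ (m + 1))) := by
    rw [← hθm]; exact (RingHom.comap_ker _ _).symm
  have h2 : RingHom.ker θm =
      ((RingHom.ker θm).comap (Ideal.Quotient.mk (maximalIdeal O ^ (m + 1)))).map (Ideal.Quotient.mk (maximalIdeal O ^ (m + 1))) :=
    (Ideal.map_comap_of_surjective _ Ideal.Quotient.mk_surjective _).symm
  rw [h2, ← h1, ker_eq_maximalIdeal_of_surjective θ hθ]

/-- Every prime of the level `O ⧸ 𝔪ᵐ⁺¹` is `𝔪(O ⧸ 𝔪ᵐ⁺¹)`. [folklore] -/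
theorem eq_map_maximalIdeal_of_isPrime (p : Ideal (O ⧸ maximalIdeal O ^ (m + 1))) [hp : p.IsPrime] :
    p = (maximalIdeal O).map (Ideal.Quotient.mk (maximalIdeal O ^ (m + 1))) := by
  -- `𝔪 ≤ comap mk p` since `𝔪`-elements are nilpotent in the level, hence `comap mk p = 𝔪`
  have hle : maximalIdeal O ≤ p.comap (Ideal.Quotient.mk (maximalIdeal O ^ (m + 1))) := by
    intro a ha
    rw [Ideal.mem_comap]
    have hpow : (Ideal.Quotient.mk (maximalIdeal O ^ (m + 1)) a) ^ (m + 1) = 0 := by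
      rw [← map_pow, Ideal.Quotient.eq_zero_iff_mem]
      exact Ideal.pow_mem_pow ha (m + 1)
    exact hp.mem_of_pow_mem (m + 1) (hpow ▸ p.zero_mem)
  have hne : p.comap (Ideal.Quotient.mk (maximalIdeal O ^ (m + 1))) ≠ ⊤ :=
    (Ideal.comap_ne_top _ hp.ne_top)
  have heq : p.comap (Ideal.Quotient.mk (maximalIdeal O ^ (m + 1))) = maximalIdeal O :=
    ((maximalIdeal.isMaximal O).eq_of_le hne hle).symm
  calc p = (p.comap (Ideal.Quotient.mk (maximalIdeal O ^ (m + 1)))).map (Ideal.Quotient.mk (maximalIdeal O ^ (m + 1))) :=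
        (Ideal.map_comap_of_surjective _ Ideal.Quotient.mk_surjective p).symm
    _ = _ := by rw [heq]

/-- `Spec k → Spec (O ⧸ 𝔪ᵐ⁺¹)` is surjective (the level has one point). [folklore] -/
theorem surjective_specMap_levelResidue (hθ : Function.Surjective θ) (hθm : θm.comp (Ideal.Quotient.mk _) = θ) :
    Surjective (Spec.map (CommRingCat.ofHom θm)) := by
  refine ⟨fun x => ⟨default, ?_⟩⟩
  have hb : ∀ y : Spec (.of k), (Spec.map (CommRingCat.ofHom θm)).base y = PrimeSpectrum.comap θm y := fun y => rfl
  rw [hb]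
  apply PrimeSpectrum.ext
  rw [PrimeSpectrum.comap_asIdeal, Scheme.default_asIdeal, ← RingHom.ker_eq_comap_bot, ker_levelResidue_eq hθ hθm,
    ← eq_map_maximalIdeal_of_isPrime x.asIdeal]

end Algebra

/-! ## §0' Two general lemmas -/

/-- A pullback square whose bottom corner factors through a monomorphism stays a pullback square over the smaller corner
(Mathlib `PullbackCone.isLimitOfFactors`). [folklore] -/
theorem isPullback_of_fac_mono {C : Type*} [Category C] {P X Y W Z : C} {fst : P ⟶ X} {snd : P ⟶ Y} {f : X ⟶ Z} {g : Y ⟶ Z}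
    (h : W ⟶ Z) [Mono h] (x : X ⟶ W) (y : Y ⟶ W) (hx : x ≫ h = f) (hy : y ≫ h = g) (H : IsPullback fst snd f g) :
    IsPullback fst snd x y :=
  IsPullback.of_isLimit' ⟨(cancel_mono h).1 (by simp only [Category.assoc, hx, hy, H.w])⟩
    (PullbackCone.isLimitOfFactors f g h x y hx hy H.cone H.isLimit)

/-- Lifting a list along a surjection inside an ideal: if every member of `l` lies in `I.map φ`, then `l = l'.map φ` for some `l' ⊆ I`.
[folklore] -/
theorem exists_list_map_eq_of_forall_mem_map {A B : Type*} [CommRing A] [CommRing B] (φ : A →+* B) (hφ : Function.Surjective φ)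
    (I : Ideal A) (l : List B) (hl : ∀ r ∈ l, r ∈ I.map φ) : ∃ l' : List A, l'.map φ = l ∧ ∀ a ∈ l', a ∈ I := by
  induction l with
  | nil => exact ⟨[], rfl, fun a ha => by simp at ha⟩
  | cons r l ih =>
    obtain ⟨l', hl', hI⟩ := ih fun s hs => hl s (List.mem_cons_of_mem r hs)
    obtain ⟨a, haI, har⟩ := (Ideal.mem_map_iff_of_surjective φ hφ).mp (hl r (List.mem_cons_self))
    refine ⟨a :: l', by simp [hl', har], fun b hb => ?_⟩
    rcases List.mem_cons.mp hb with rfl | hb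
    · exact haI
    · exact hI b hb

/-- **Weak regularity through a surjection.** If `φ : A → B` is surjective and `as.map φ` is weakly regular on `B`, then `as` is
weakly regular on the `A`-module `A ⧸ I` for any `I = ker φ`. [folklore] -/
theorem isWeaklyRegular_quotient_of_surjective {A B : Type*} [CommRing A] [CommRing B] (φ : A →+* B)
    (hφ : Function.Surjective φ) {I : Ideal A} (hI : I = RingHom.ker φ) (as : List A)
    (h : RingTheory.Sequence.IsWeaklyRegular B (as.map φ)) :
    RingTheory.Sequence.IsWeaklyRegular (A ⧸ I) as := by
  subst hI
  refine (AddEquiv.isWeaklyRegular_congr (e := (RingHom.quotientKerEquivOfSurjective hφ).toAddEquiv) (as := as)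
    (bs := as.map φ) ?_).mpr h
  refine List.forall₂_map_right_iff.mpr (List.forall₂_same.mpr fun a _ x => ?_)
  obtain ⟨y, rfl⟩ := Ideal.Quotient.mk_surjective x
  change RingHom.quotientKerEquivOfSurjective hφ (a • Ideal.Quotient.mk _ y) =
    φ a * RingHom.quotientKerEquivOfSurjective hφ (Ideal.Quotient.mk _ y)
  rw [Algebra.smul_def, Ideal.Quotient.algebraMap_eq, map_mul, RingHom.quotientKerEquivOfSurjective_apply_mk]

/-- The kernel of a composite on a chart: `ker ((f ≫ g).app U) = (g.app U)⁻¹ (ker (f.app (g⁻¹U)))`. [folklore] -/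
theorem ker_comp_app_eq_comap {X Y Z : Scheme.{0}} (f : X ⟶ Y) (g : Y ⟶ Z) (U : Z.Opens) :
    RingHom.ker ((f ≫ g).app U).hom = (RingHom.ker (f.app (g ⁻¹ᵁ U)).hom).comap (g.app U).hom :=
  Ideal.ext fun _ => Iff.rfl

/-! ## §1 The special fibre `W₀` inside the level `Wₘ` -/

section Fibre

variable {O : Type} [CommRing O] [IsDomain O] [IsDiscreteValuationRing O] {k : Type} [Field k] {θ : O →+* k}
  {W : Scheme.{0}} (w : W ⟶ Spec (.of O)) {W₀ : Scheme.{0}} {jW : W₀ ⟶ W} {tW : W₀ ⟶ Spec (.of k)}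
  {m : ℕ} {θm : O ⧸ maximalIdeal O ^ (m + 1) →+* k}

/-- The special fibre maps to every level: `e : W₀ → Wₘ` with `e ≫ ι = jW` and `e ≫ toSpec = tW ≫ Spec θm`
(needs only `jW ≫ w = tW ≫ Spec θ`). [folklore] -/
theorem exists_specialFibre_toLevel (hθm : θm.comp (Ideal.Quotient.mk _) = θ)
    (hw : jW ≫ w = tW ≫ Spec.map (CommRingCat.ofHom θ)) :
    ∃ e : W₀ ⟶ infinitesimalNeighbourhood (maximalIdeal O) w m,
      e ≫ infinitesimalNeighbourhood.ι (maximalIdeal O) w m = jW ∧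
      e ≫ infinitesimalNeighbourhood.toSpec (maximalIdeal O) w m = tW ≫ Spec.map (CommRingCat.ofHom θm) := by
  have hcomm : jW ≫ w = (tW ≫ Spec.map (CommRingCat.ofHom θm)) ≫ infinitesimalNeighbourhood.base (maximalIdeal O) m := by
    rw [hw, Category.assoc, infinitesimalNeighbourhood.base, ← Spec.map_comp, ← CommRingCat.ofHom_comp, hθm]
  exact ⟨pullback.lift jW (tW ≫ Spec.map (CommRingCat.ofHom θm)) hcomm, pullback.lift_fst _ _ _, pullback.lift_snd _ _ _⟩

variable {w} {e : W₀ ⟶ infinitesimalNeighbourhood (maximalIdeal O) w m}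

/-- **The special fibre is the base change of the level along `Spec k → Spec (O ⧸ 𝔪ᵐ⁺¹)`.** [folklore] -/
theorem isPullback_specialFibre_toLevel (hsq : IsPullback jW tW w (Spec.map (CommRingCat.ofHom θ)))
    (hθm : θm.comp (Ideal.Quotient.mk _) = θ)
    (he₁ : e ≫ infinitesimalNeighbourhood.ι (maximalIdeal O) w m = jW)
    (he₂ : e ≫ infinitesimalNeighbourhood.toSpec (maximalIdeal O) w m = tW ≫ Spec.map (CommRingCat.ofHom θm)) :
    IsPullback e tW (infinitesimalNeighbourhood.toSpec (maximalIdeal O) w m) (Spec.map (CommRingCat.ofHom θm)) := by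
  have hbase : Spec.map (CommRingCat.ofHom θm) ≫ infinitesimalNeighbourhood.base (maximalIdeal O) m =
      Spec.map (CommRingCat.ofHom θ) := by
    rw [infinitesimalNeighbourhood.base, ← Spec.map_comp, ← CommRingCat.ofHom_comp, hθm]
  have big : IsPullback (e ≫ infinitesimalNeighbourhood.ι (maximalIdeal O) w m) tW w
      (Spec.map (CommRingCat.ofHom θm) ≫ infinitesimalNeighbourhood.base (maximalIdeal O) m) := by
    rw [he₁, hbase]; exact hsq
  exact big.of_right he₂ (IsPullback.of_hasPullback w (infinitesimalNeighbourhood.base (maximalIdeal O) m))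

/-- `e : W₀ → Wₘ` is a closed immersion. [folklore] -/
theorem isClosedImmersion_specialFibre_toLevel (hsq : IsPullback jW tW w (Spec.map (CommRingCat.ofHom θ)))
    (hθ : Function.Surjective θ) (hθm : θm.comp (Ideal.Quotient.mk _) = θ)
    (he₁ : e ≫ infinitesimalNeighbourhood.ι (maximalIdeal O) w m = jW)
    (he₂ : e ≫ infinitesimalNeighbourhood.toSpec (maximalIdeal O) w m = tW ≫ Spec.map (CommRingCat.ofHom θm)) :
    IsClosedImmersion e :=
  haveI : IsClosedImmersion (Spec.map (CommRingCat.ofHom θm)) :=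
    IsClosedImmersion.spec_of_surjective _ (levelResidue_surjective hθ hθm)
  MorphismProperty.IsStableUnderBaseChange.of_isPullback (isPullback_specialFibre_toLevel hsq hθm he₁ he₂).flip inferInstance

/-- `e : W₀ → Wₘ` is surjective. [folklore] -/
theorem surjective_specialFibre_toLevel (hsq : IsPullback jW tW w (Spec.map (CommRingCat.ofHom θ)))
    (hθ : Function.Surjective θ) (hθm : θm.comp (Ideal.Quotient.mk _) = θ)
    (he₁ : e ≫ infinitesimalNeighbourhood.ι (maximalIdeal O) w m = jW)
    (he₂ : e ≫ infinitesimalNeighbourhood.toSpec (maximalIdeal O) w m = tW ≫ Spec.map (CommRingCat.ofHom θm)) :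
    Surjective e :=
  haveI : Surjective (Spec.map (CommRingCat.ofHom θm)) := surjective_specMap_levelResidue hθ hθm
  MorphismProperty.IsStableUnderBaseChange.of_isPullback (isPullback_specialFibre_toLevel hsq hθm he₁ he₂).flip inferInstance

/-- A surjective closed immersion carries opens to opens (it is a homeomorphism). [folklore] -/
theorem isOpen_image_of_isClosedImmersion_of_surjective {X Y : Scheme.{0}} (f : X ⟶ Y) [IsClosedImmersion f] [Surjective f]
    (V : X.Opens) : IsOpen (f.base '' (V : Set X)) := by
  have hbij : Function.Bijective f.base := ⟨f.isClosedEmbedding.injective, f.surjective⟩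
  rw [← compl_compl (f.base '' (V : Set X)), ← Set.image_compl_eq hbij]
  exact (f.isClosedEmbedding.isClosedMap _ V.2.isClosed_compl).isOpen_compl

/-- **Small affine charts of the level seen from the fibre**: every open `V ∋ z` of `X` contains `f⁻¹U` for some affine open `U ∋ f z` of
`Y` inside any prescribed open `N ∋ f z`, when `f` is a surjective closed immersion. [folklore] -/
theorem exists_affineOpens_preimage_le {X Y : Scheme.{0}} (f : X ⟶ Y) [IsClosedImmersion f] [Surjective f]
    (V : X.Opens) {z : X} (hz : z ∈ V) (N : Y.Opens) (hN : f.base z ∈ N) :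
    ∃ U : Y.affineOpens, f.base z ∈ (U : Y.Opens) ∧ f ⁻¹ᵁ (U : Y.Opens) ≤ V ∧ (U : Y.Opens) ≤ N := by
  let V' : Y.Opens := ⟨f.base '' (V : Set X), isOpen_image_of_isClosedImmersion_of_surjective f V⟩
  have hzV' : f.base z ∈ V' ⊓ N := ⟨⟨z, hz, rfl⟩, hN⟩
  obtain ⟨U, hU, hzU, hUle⟩ := (Opens.isBasis_iff_nbhd.mp (Scheme.isBasis_affineOpens Y)) hzV'
  refine ⟨⟨U, hU⟩, hzU, fun x hx => ?_, fun y hy => (hUle hy).2⟩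
  obtain ⟨v, hv, hvx⟩ := (hUle hx).1
  rwa [← f.isClosedEmbedding.injective hvx]

/-- D3a in the `comap` currency of D1 (`ker_app_transition_eq_map`): the kernel of `Γ(Wₘ, U) → Γ(W₀, e⁻¹U)` is the maximal ideal of the
level, read in `Γ(Spec, ⊤)` and extended along `(toSpec m).appLE ⊤ U`. [folklore] -/
theorem ker_app_specialFibre_toLevel' (hsq : IsPullback jW tW w (Spec.map (CommRingCat.ofHom θ)))
    (hθ : Function.Surjective θ) (hθm : θm.comp (Ideal.Quotient.mk _) = θ)
    (he₁ : e ≫ infinitesimalNeighbourhood.ι (maximalIdeal O) w m = jW)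
    (he₂ : e ≫ infinitesimalNeighbourhood.toSpec (maximalIdeal O) w m = tW ≫ Spec.map (CommRingCat.ofHom θm))
    (U : (infinitesimalNeighbourhood (maximalIdeal O) w m).affineOpens) :
    RingHom.ker (e.app (U : (infinitesimalNeighbourhood (maximalIdeal O) w m).Opens)).hom =
      (((maximalIdeal O).map (Ideal.Quotient.mk (maximalIdeal O ^ (m + 1)))).comap
          (Scheme.ΓSpecIso (.of (O ⧸ maximalIdeal O ^ (m + 1)))).hom.hom).map
        ((infinitesimalNeighbourhood.toSpec (maximalIdeal O) w m).appLE ⊤ U le_top).hom := by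
  rw [ker_app_eq_map_of_isPullback_specMap (CommRingCat.ofHom θm) (levelResidue_surjective hθ hθm)
    (isPullback_specialFibre_toLevel hsq hθm he₁ he₂) U, CommRingCat.hom_ofHom, ker_levelResidue_eq hθ hθm]

/-- Reading an ideal through a ring isomorphism of `CommRingCat`: `comap e.hom = map e.inv`. [folklore] -/
theorem comap_hom_eq_map_inv {R S : CommRingCat.{0}} (e : R ≅ S) (J : Ideal S) : J.comap e.hom.hom = J.map e.inv.hom := by
  apply le_antisymm
  · intro x hx
    rw [Ideal.mem_comap] at hx
    have : x = e.inv.hom (e.hom.hom x) := (CommRingCat.inv_hom_apply e x).symm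
    rw [this]
    exact Ideal.mem_map_of_mem _ hx
  · rw [Ideal.map_le_iff_le_comap]
    intro s hs
    rw [Ideal.mem_comap, Ideal.mem_comap, CommRingCat.hom_inv_apply e s]
    exact hs

/-- **D3a. The kernel of `Γ(Wₘ, U) → Γ(W₀, e⁻¹U)` is `𝔪·Γ(Wₘ, U)`** (`U` affine; the maximal ideal of the level extended along the structure
map `O ⧸ 𝔪ᵐ⁺¹ → Γ(Spec, ⊤) → Γ(Wₘ, U)`). [folklore] -/
theorem ker_app_specialFibre_toLevel (hsq : IsPullback jW tW w (Spec.map (CommRingCat.ofHom θ)))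
    (hθ : Function.Surjective θ) (hθm : θm.comp (Ideal.Quotient.mk _) = θ)
    (he₁ : e ≫ infinitesimalNeighbourhood.ι (maximalIdeal O) w m = jW)
    (he₂ : e ≫ infinitesimalNeighbourhood.toSpec (maximalIdeal O) w m = tW ≫ Spec.map (CommRingCat.ofHom θm))
    (U : (infinitesimalNeighbourhood (maximalIdeal O) w m).affineOpens) :
    RingHom.ker (e.app (U : (infinitesimalNeighbourhood (maximalIdeal O) w m).Opens)).hom =
      ((maximalIdeal O).map (Ideal.Quotient.mk (maximalIdeal O ^ (m + 1)))).map
        (((infinitesimalNeighbourhood.toSpec (maximalIdeal O) w m).appLE ⊤ U le_top).hom.comp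
          (Scheme.ΓSpecIso (.of (O ⧸ maximalIdeal O ^ (m + 1)))).inv.hom) := by
  rw [ker_app_specialFibre_toLevel' hsq hθ hθm he₁ he₂ U, comap_hom_eq_map_inv, Ideal.map_map]

/-- `Γ(Wₘ, U) → Γ(W₀, e⁻¹U)` is surjective for affine `U`. [folklore] -/
theorem app_specialFibre_toLevel_surjective (hsq : IsPullback jW tW w (Spec.map (CommRingCat.ofHom θ)))
    (hθ : Function.Surjective θ) (hθm : θm.comp (Ideal.Quotient.mk _) = θ)
    (he₁ : e ≫ infinitesimalNeighbourhood.ι (maximalIdeal O) w m = jW)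
    (he₂ : e ≫ infinitesimalNeighbourhood.toSpec (maximalIdeal O) w m = tW ≫ Spec.map (CommRingCat.ofHom θm))
    (U : (infinitesimalNeighbourhood (maximalIdeal O) w m).affineOpens) :
    Function.Surjective (e.app (U : (infinitesimalNeighbourhood (maximalIdeal O) w m).Opens)).hom :=
  haveI := isClosedImmersion_specialFibre_toLevel hsq hθ hθm he₁ he₂
  e.app_surjective (U : (infinitesimalNeighbourhood (maximalIdeal O) w m).Opens) U.2

/-- **D0. The chart rings of a level are flat over the level** when `w` is flat. [folklore] -/
theorem flat_appLE_toSpec [Flat w] (U : (infinitesimalNeighbourhood (maximalIdeal O) w m).affineOpens) :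
    ((infinitesimalNeighbourhood.toSpec (maximalIdeal O) w m).appLE ⊤ U le_top).hom.Flat :=
  haveI : Flat (infinitesimalNeighbourhood.toSpec (maximalIdeal O) w m) :=
    MorphismProperty.pullback_snd _ _ inferInstance
  HasRingHomProperty.appLE (P := @Flat) (f := infinitesimalNeighbourhood.toSpec (maximalIdeal O) w m) inferInstance
    ⟨⊤, isAffineOpen_top _⟩ U le_top

end Fibre

/-! ## §2 D4: the ideal of `Y₀` is the image of the ideal of `Yₙ` -/

section IdealOfFibre

variable {O : Type} [CommRing O] [IsDomain O] [IsDiscreteValuationRing O] {k : Type} [Field k] {θ : O →+* k}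
  {W : Scheme.{0}} {w : W ⟶ Spec (.of O)} {W₀ : Scheme.{0}} {jW : W₀ ⟶ W} {tW : W₀ ⟶ Spec (.of k)}
  {n : ℕ} {e : W₀ ⟶ infinitesimalNeighbourhood (maximalIdeal O) w (n + 1)}
  {Y₀ : Scheme.{0}} {ι : Y₀ ⟶ W₀} {Yn : Scheme.{0}} {jn : Yn ⟶ infinitesimalNeighbourhood (maximalIdeal O) w n} {s₀ : Y₀ ⟶ Yn}

/-- The `s₀` square over `W` is a square over the level `Wₙ₊₁`: `Y₀ = Yₙ ×_{Wₙ₊₁} W₀`. [folklore] -/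
theorem isPullback_fibre_of_isPullback_ι (hs₀ : IsPullback s₀ ι (jn ≫ infinitesimalNeighbourhood.ι (maximalIdeal O) w n) jW)
    (he₁ : e ≫ infinitesimalNeighbourhood.ι (maximalIdeal O) w (n + 1) = jW) :
    IsPullback s₀ ι (jn ≫ infinitesimalNeighbourhood.transition (maximalIdeal O) w n) e :=
  isPullback_of_fac_mono (infinitesimalNeighbourhood.ι (maximalIdeal O) w (n + 1)) _ _
    (by rw [Category.assoc, infinitesimalNeighbourhood.transition_ι]) he₁ hs₀

/-- **D4. On the chart `e⁻¹U` the ideal of `Y₀ ⊆ W₀` is the image of the ideal `K(U) = (t.app U)⁻¹(ker jn.app (t⁻¹U))` of `Yₙ`.**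
[folklore] -/
theorem ker_ideal_fibre_eq_map [IsClosedImmersion jn] [IsClosedImmersion e]
    (hs₀ : IsPullback s₀ ι (jn ≫ infinitesimalNeighbourhood.ι (maximalIdeal O) w n) jW)
    (he₁ : e ≫ infinitesimalNeighbourhood.ι (maximalIdeal O) w (n + 1) = jW)
    (U : (infinitesimalNeighbourhood (maximalIdeal O) w (n + 1)).affineOpens) :
    ι.ker.ideal ⟨e ⁻¹ᵁ (U : (infinitesimalNeighbourhood (maximalIdeal O) w (n + 1)).Opens), U.2.preimage e⟩ =
      ((RingHom.ker (jn.app (infinitesimalNeighbourhood.transition (maximalIdeal O) w n ⁻¹ᵁ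
            (U : (infinitesimalNeighbourhood (maximalIdeal O) w (n + 1)).Opens))).hom).comap
          ((infinitesimalNeighbourhood.transition (maximalIdeal O) w n).app
            (U : (infinitesimalNeighbourhood (maximalIdeal O) w (n + 1)).Opens)).hom).map
        (e.app (U : (infinitesimalNeighbourhood (maximalIdeal O) w (n + 1)).Opens)).hom := by
  haveI := isClosedImmersion_transition (maximalIdeal O) w n
  have H := isPullback_fibre_of_isPullback_ι hs₀ he₁
  -- `ι.ker = (jn ≫ t).ker.comap e`
  have hker : ι.ker = (jn ≫ infinitesimalNeighbourhood.transition (maximalIdeal O) w n).ker.comap e := by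
    rw [← Scheme.IdealSheafData.ker_fst_of_isClosedImmersion (jn ≫ infinitesimalNeighbourhood.transition (maximalIdeal O) w n) e,
      ← H.flip.isoPullback_hom_fst, Scheme.Hom.ker_comp_of_isIso]
  rw [hker, comap_ideal_chart e _ U, Scheme.Hom.ker_apply _ U, ← Scheme.Hom.app_eq_appLE, ker_comp_app_eq_comap]

/-- **B4 INPUT PACKAGE at a point of `Y₀`.** From the lci chart `Uz ∋ ι z` of `Y₀ ⊆ W₀` (weakly regular generators `rs` of `𝓘_{Y₀}(Uz)`)
and any open `N ∋ e (ι z)` of the level `Wₙ₊₁`: an AFFINE chart `U ∋ e (ι z)`, `U ≤ N`, and a list `a' ⊆ K(U)` (the ideal of `Yₙ` read in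
`Γ(Wₙ₊₁, U)`) which is weakly regular on `Γ(Wₙ₊₁, U) ⧸ 𝔪·Γ(Wₙ₊₁, U)` and generates `K(U)` modulo `𝔪` — literally the hypotheses
`hreg`/`hmem`/`hgen` of the ring core `exists_flat_lift_sup_eq_of_isWeaklyRegular_fiber` (p606077) for the `O ⧸ 𝔪ⁿ⁺²`-algebra structure
`(toSpec (n+1)).appLE ⊤ U ∘ ΓSpecIso⁻¹` on `Γ(Wₙ₊₁, U)`. [OURS · L1 W4.5b · J1c B4 dictionary] toward `stub_elnat_embeddedInfinitesimalLiftFact`;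
NOT a statement of the manuscript. -/
theorem exists_chart_weaklyRegular_lift_data {θm : O ⧸ maximalIdeal O ^ (n + 1 + 1) →+* k}
    (hsq : IsPullback jW tW w (Spec.map (CommRingCat.ofHom θ))) (hθ : Function.Surjective θ)
    (hθm : θm.comp (Ideal.Quotient.mk _) = θ)
    (he₁ : e ≫ infinitesimalNeighbourhood.ι (maximalIdeal O) w (n + 1) = jW)
    (he₂ : e ≫ infinitesimalNeighbourhood.toSpec (maximalIdeal O) w (n + 1) = tW ≫ Spec.map (CommRingCat.ofHom θm))
    [IsClosedImmersion jn] (hs₀ : IsPullback s₀ ι (jn ≫ infinitesimalNeighbourhood.ι (maximalIdeal O) w n) jW)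
    {z : Y₀} {Uz : W₀.affineOpens} (hz : ι.base z ∈ (Uz : W₀.Opens))
    (hUz : ∃ rs : List Γ(W₀, Uz), RingTheory.Sequence.IsWeaklyRegular Γ(W₀, Uz) rs ∧ Ideal.ofList rs = ι.ker.ideal Uz)
    (N : (infinitesimalNeighbourhood (maximalIdeal O) w (n + 1)).Opens) (hN : e.base (ι.base z) ∈ N) :
    ∃ U : (infinitesimalNeighbourhood (maximalIdeal O) w (n + 1)).affineOpens,
      e.base (ι.base z) ∈ (U : (infinitesimalNeighbourhood (maximalIdeal O) w (n + 1)).Opens) ∧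
      (U : (infinitesimalNeighbourhood (maximalIdeal O) w (n + 1)).Opens) ≤ N ∧
      ∃ as' : List Γ(infinitesimalNeighbourhood (maximalIdeal O) w (n + 1), U),
        RingTheory.Sequence.IsWeaklyRegular
          (Γ(infinitesimalNeighbourhood (maximalIdeal O) w (n + 1), U) ⧸
            ((maximalIdeal O).map (Ideal.Quotient.mk (maximalIdeal O ^ (n + 1 + 1)))).map
              (((infinitesimalNeighbourhood.toSpec (maximalIdeal O) w (n + 1)).appLE ⊤ U le_top).hom.comp
                (Scheme.ΓSpecIso (.of (O ⧸ maximalIdeal O ^ (n + 1 + 1)))).inv.hom)) as' ∧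
        (∀ a ∈ as', a ∈ ((RingHom.ker (jn.app (infinitesimalNeighbourhood.transition (maximalIdeal O) w n ⁻¹ᵁ
            (U : (infinitesimalNeighbourhood (maximalIdeal O) w (n + 1)).Opens))).hom).comap
          ((infinitesimalNeighbourhood.transition (maximalIdeal O) w n).app
            (U : (infinitesimalNeighbourhood (maximalIdeal O) w (n + 1)).Opens)).hom)) ∧
        ((RingHom.ker (jn.app (infinitesimalNeighbourhood.transition (maximalIdeal O) w n ⁻¹ᵁ
            (U : (infinitesimalNeighbourhood (maximalIdeal O) w (n + 1)).Opens))).hom).comap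
          ((infinitesimalNeighbourhood.transition (maximalIdeal O) w n).app
            (U : (infinitesimalNeighbourhood (maximalIdeal O) w (n + 1)).Opens)).hom) ≤
          Ideal.ofList as' ⊔
            ((maximalIdeal O).map (Ideal.Quotient.mk (maximalIdeal O ^ (n + 1 + 1)))).map
              (((infinitesimalNeighbourhood.toSpec (maximalIdeal O) w (n + 1)).appLE ⊤ U le_top).hom.comp
                (Scheme.ΓSpecIso (.of (O ⧸ maximalIdeal O ^ (n + 1 + 1)))).inv.hom) := by
  haveI := isClosedImmersion_specialFibre_toLevel hsq hθ hθm he₁ he₂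
  haveI := surjective_specialFibre_toLevel hsq hθ hθm he₁ he₂
  obtain ⟨U, hzU, hUV, hUN⟩ := exists_affineOpens_preimage_le e (Uz : W₀.Opens) hz N hN
  refine ⟨U, hzU, hUN, ?_⟩
  -- weakly regular generators restricted to the affine `e⁻¹U ≤ Uz` (B3)
  obtain ⟨rs, hreg, hgen⟩ := exists_isWeaklyRegular_generators_of_le ι.ker
    (U := ⟨e ⁻¹ᵁ (U : (infinitesimalNeighbourhood (maximalIdeal O) w (n + 1)).Opens), U.2.preimage e⟩) (V := Uz) hUV hUz
  have hD4 := ker_ideal_fibre_eq_map hs₀ he₁ U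
  have hsurj := app_specialFibre_toLevel_surjective hsq hθ hθm he₁ he₂ U
  have hkerU := ker_app_specialFibre_toLevel hsq hθ hθm he₁ he₂ U
  -- lift the generators INSIDE `K(U)` (D4: `𝓘_{Y₀}(e⁻¹U) = K(U)·Γ(W₀, e⁻¹U)`)
  obtain ⟨as', has', hmem⟩ := exists_list_map_eq_of_forall_mem_map
    (e.app (U : (infinitesimalNeighbourhood (maximalIdeal O) w (n + 1)).Opens)).hom hsurj _ rs fun r hr => by
      rw [← hD4, ← hgen]; exact Ideal.subset_span hr
  refine ⟨as', ?_, hmem, fun x hx => ?_⟩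
  · -- weak regularity on `Γ(U) ⧸ 𝔪Γ(U) ≅ Γ(W₀, e⁻¹U)` (D3a)
    refine isWeaklyRegular_quotient_of_surjective _ hsurj hkerU.symm as' ?_
    rw [has']; exact hreg
  · -- generation modulo `𝔪`: `e♯ x ∈ 𝓘_{Y₀}(e⁻¹U) = (a')·Γ(W₀, e⁻¹U)`, so `x ∈ (a') + ker e♯ = (a') + 𝔪Γ(U)`
    have hx' : (e.app (U : (infinitesimalNeighbourhood (maximalIdeal O) w (n + 1)).Opens)).hom x ∈ Ideal.ofList rs := by
      rw [hgen, hD4]; exact Ideal.mem_map_of_mem _ hx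
    rw [← has', ← Ideal.map_ofList] at hx'
    obtain ⟨y, hy, hyx⟩ := (Ideal.mem_map_iff_of_surjective _ hsurj).mp hx'
    have hdiff : x - y ∈ RingHom.ker (e.app (U : (infinitesimalNeighbourhood (maximalIdeal O) w (n + 1)).Opens)).hom := by
      rw [RingHom.mem_ker, map_sub, hyx, sub_self]
    rw [hkerU] at hdiff
    rw [show x = y + (x - y) by ring]
    exact Submodule.add_mem_sup hy hdiff

end IdealOfFibre

end Summit.ResolutionOfSingularities.ResolutionOfSingularities.Cruxes.EquisingularLiftNat.Sections

end
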